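import Literature.MathematicalPhysics.QuantumFieldTheory.BalabanImbrieJaffe1984to88.BIJ88InteriorChartLaw
import Literature.MathematicalPhysics.QuantumFieldTheory.BalabanImbrieJaffe1984to88.BIJ88Eq596Density
import Literature.MathematicalPhysics.QuantumFieldTheory.BalabanImbrieJaffe1984to88.BIJ88FreeCount48

/-!
# `BalabanImbrieJaffe1984to88.BIJ88Eq5128NonVacuity` — T. Bałaban, J. Imbrie, A. Jaffe, *Effective action and cluster properties of the
abelian Higgs model*, Commun. Math. Phys. **114** (1988) 257–315 [BalabanImbrieJaffe1988], (5.12.8) p. 303 [PDF 47]: *"After the conditioning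
our density assumes the following form"* (the display (5.12.8), verbatim in `BIJ88Eq5128Display`), with (5.12.3) p. 301 *"The A^{(k)″}
integral includes the replacement of du^{(k)} with dA^{(k)} for the free variables …"* and (5.12.7) p. 302 — **A KERNEL NON-VACUITY CERTIFICATE
FOR THE HEAD THEOREM `BIJ88InteriorChartLaw.eq5128_gauge_torus` OF ROW C2.Eq5.12.8** (flipped typed → proved-with-clauses on it, ROWS-C2-part2
v2.139, countersigned R-g46-1): a closed instance, for EVERY torus `P` of the standing range, every step `k` (`k + 1 ≤ m + K`) AND EVERY CHOICE
OF THE PREVIOUS-FIELD AND SCALAR INTERIORS `Λ^{(j)c*c}_{10}` (`j < k`), `Λ^{(k)}_{10}`, in which ALL hypotheses of `eq5128_gauge_torus` — the (5.9.6)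
input display, the numerics, the two fat-interior compatibilities, the symmetry/positivity of the gauge and scalar kernels, the readings
(`hv`, `hX₀`, `hJ`), the measurability/retraction/window data of the interior bracket, the support reading `hXsmall` and the integrability `hJi` —
are DISCHARGED by the kernel for explicit data with every binder inhabited.

statement-level skeleton of published theorems with citation tags; proofs where landed; nothing here is a claim about the Yang–Mills mass gap

WHY (the lesson of the C2.Eq5.9.6 flip, ref-5 F6 (b) / R-g51-1, r16 v2.166: *"a kernel NON-VACUITY CERTIFICATE — a closed … instance … showing
the hypothesis family jointly satisfiable with every binder inhabited; if some reading/… pair turns out contradictory the head returns to typed"*).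
The head of the OTHER E-row of this seat's lineage, (5.12.8), was flipped on p34 g12's `eq5128_gauge_torus` (p325329) with ~20 displayed
hypotheses and had no such certificate; this file supplies it.

THE DATA (§1).  One term (`ι = Unit`); charge `e_k = 1`; window radius and margin `r = ε = 1/(8(d+1)L)` (so `2(d+1)L·e_k(r+ε) = ½ < π`);
* cut-off `Λ_t := T^{(k+1)*}` — ALL block-lattice bonds (every block variable freed: the translated field `u′_Λ(u)` has all block averages `1`);
* interior datum `cD Ip Ix := ⟨Λ^{(k)c*c}_{10} := ALL unit-lattice bonds, Λ^{(j)c*c}_{10} := Ip j, Λ^{(k)}_{10} := Ix⟩` with `Ip`, `Ix` ARBITRARY — so the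
  gauge interior carries the FULL (4.8) constraint structure (tree bonds `δ_{Ax}`, and the linearized block-average constraint `δ(QA)` at
  every block bond that is the coarse bond of a crossing unit bond, `mem_cset_cD`), the exterior gauge bonds are none, and the two fat-interior
  compatibilities hold trivially;
* kernels `T_t := 1` (gauge, on unit bonds) and `M_t(v) := 1` (scalar, on the real coordinates `sites × {re, im}`);
* the bracket `cJ`: `J_t({u^{(j)}}, u, v, φ, ψ) := e^{−½Σ_y|ψ(y)|²} · exp[expo523(1)(A(u))] · e^{−½⟨realCoords φ, realCoords φ⟩} · 𝟙{|A(u)_b| ≤ r ∀b}` with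
  `A(u)_b = aOf 1 u_b` the Lie-algebra coordinate (p34 g12's `aOf`) — a Gaussian in `ψ`, print's gauge Gaussian (5.12.3) with `T = 1` in the
  coordinates of the translated bond variables, print's scalar Gaussian with `M = 1`, and a small-field window on the interior gauge coordinates;
  the exterior bracket `cX₀ := e^{−½Σ|ψ|²}`, the interior bracket `cB₀ :=` the window read on `aIn`;
* the (5.9.6) input `h`: gen 9's CONSTRUCTED density `rho596` with `isDT_rho596` (Radon–Nikodym; standing range) — by name.

WHAT IS PROVED (§2–§5; 0 `sorry`, standard axioms, NO `Prop`-valued fact).  §2 kernels: `blkIn_one_posDef` (a principal block of `1` is positive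
definite), **`precK_one_posDef`** (hypothesis `hK`: print's precision `Eᵀ·1·E` on the free coordinates of the (4.8) constraint space is positive
definite for EVERY interior datum and cut-off — `E = Emat` has a basis of the free space as columns, hence is injective; Mathlib's
`Matrix.PosDef.conjTranspose_mul_mul_same`); §3 numerics `rad_pos`, `hnum_cert`; §4 the bracket: `gScalar_eq` (`⟨realCoords φ, realCoords φ⟩ =
Σ_x|φ(x)|²`), the Gaussian integrabilities `integrable_gaussC`, `integrable_gψ`, `integrable_gScalarC`, `measurable_coordIn`, `gGauge_le`
(`gauge weight ≤ exp(expoBound)`, p34 g12's `abs_expo523_le`), **`integrable_uFactor`** (the bounded measurable `u`-factor is integrable for every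
finite `u`-law), **`integrable_fields`** (hypothesis of `isDT_rho596`: the bracket is integrable on the configurations of the term — product of
integrable factors, `Integrable.mul_prod`), **`integrable_term`** (hypothesis `hJi` on `termMeasure (Π_b axialLaw_b)`), `measurable_cB₀` (`hBm`),
`cB₀_retr` (`hBretr` — BY NAME from p34 g12's `aIn_glue` and the idempotence `uCut_gl_idem` of the translation on the interior), `cB₀_win` (`hBwin`);
§5 **`eq5128_gauge_torus_nonvacuous`**: the conclusion of `eq5128_gauge_torus` (the display `IsDC` with print's exterior normaliser `normPrint` and
interior law `lawInt`) for these data, obtained by APPLYING it with all hypotheses discharged in place.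

v1.1 (append-only: §6–§7 and one import, r18's `BIJ88FreeCount48`; every v1.0 declaration byte-identical) — THE ROW OWNER'S NON-DEGENERACY
CRITERIA N1–N5 (r16, C2.Eq5.12.8 cell note ROWS-C2-part2 v2.181; *"the data are NON-DEGENERATE where the hypotheses could otherwise hold
vacuously"*), KERNEL-CHECKED: **N1** `terms_nonempty`; **N2** `cX₀_ne_zero` (the exterior bracket `X₀ = e^{−½Σ|ψ|²}` never vanishes),
**`measure_win_pos`** / `measure_cB₀_eq_one_pos` (for EVERY exterior configuration the interior bracket `B₀` equals `1` on an event of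
positive interior measure — p34 g12's chart law `hChart` BY NAME evaluated on the whole space: probability `c_t·vol(box)` with `ct_cD_pos` and
`volume_box_pos` (the box contains a ball) — so `hBwin` fires with a true premise) and **`rhoL_not_ae_zero`** (§7: the OUTPUT density
`ρ^L_{k+1}` is not `dv dψ`-a.e. zero — by gen 9's `integral_eq_of_isDT` its total integral factorises, `integral_rhoL_eq`, as
`(∫𝒟u δ_{Ax} u-factor)·(∫dψ e^{−½Σ|ψ|²})·(∫𝒟φ e^{−½Σ|φ|²})`, three positive reals, the first because the window event has positive
`∫𝒟u δ_{Ax}`-measure, `axialMeasure_Wset_pos` = `measure_win_pos` transported along p34 g12's exterior/interior split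
`measurePreserving_splitU`); **N3** `ib_cD_nonempty` and **`cset_cD_eq_univ`** (the constrained block bonds `cset` are ALL block bonds: each is
the coarse bond of r18's crossing bond `crossBond`, so `hfat`/`hBretr`/the chart act on the full (4.8) structure); **N4** `cM_posDef` (`M = 1 ≻ 0`
on the whole real coordinate space `sites × {re, im}`, in particular on the interior block of every `Ix`; `T = 1`, `precK_one_posDef`); **N5**
`hnum_cert`, `rad_pos`, `ct_cD_pos`.  NOT MET BY THESE DATA (r16 PRE-READ 2026-08-22T16:58:41Z, declared): `hXsmall` — *"X₀ ≠ 0 ⇒ the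
exterior bonds near a constrained block bond are (r+ε)-small"* — holds because its bond binder `b ∉ Λ^{c*c}_{10}` is EMPTY (every unit bond is
interior); a certificate exercising it with a nonempty exterior (print's fat interior `X^{c*c}` of a proper union of blocks, an exterior
small-field window in `X₀`) is not in this file.

HONEST SCOPE.  A satisfiability certificate, nothing more: the data are NOT the paper's objects (unit kernels instead of `∂*σ_{k,loc}∂` and
`Δ_{Λ₁₀}(ũ)`, every block variable freed, every unit bond interior, a Gaussian bracket); what it certifies is that the ≈20 hypotheses of the
head theorem are jointly consistent with every binder inhabited, uniformly in `P`, `k` and in the previous-field/scalar interiors, with the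
gauge sector's (4.8) constraint structure, window and chart constant genuinely exercised (`mem_cset_cD`, `r > 0`).  The exterior gauge
region is empty here, so `hXsmall` and the second compatibility hold vacuously — a certificate with print's fat interior `X^{c*c}` of a proper
union of blocks needs an exterior small-field window read by `X₀` (the support of the characteristic functions, rows C2.Eq5.9.4-5.9.5) and is
not attempted here.  Imports p34 g12's `BIJ88InteriorChartLaw`, gen 9's `BIJ88Eq596Density` and (v1.1) r18's `BIJ88FreeCount48` (Literature +
Mathlib).  Seat p34 gen 14 (unit `lit-balaban-p34-g14`; TAKING line
HOME/STATUS.md 2026-08-22T16:36:00Z).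
-/

namespace Literature.MathematicalPhysics.QuantumFieldTheory.BalabanImbrieJaffe1984to88.BIJ88Eq5128NonVacuity

open Literature.MathematicalPhysics.QuantumFieldTheory.Balaban1983to89
open BIJ88Sect3Statements (U1 toC)
open BIJ85Sect1Model (HiggsField)
open BIJ85BlockAveragesTorus (qU IsCross coarse)
open BIJ88RenormTransf311 (axialMeasure)
open BIJ88InductiveForm41 (Prev prevMeasure)
open BIJ88RT52Restrictions (Fields fieldsMeasure)
open BIJ88Eq596Display (uCut vCut vCut_apply IsDT)
open BIJ88Eq596Density (rho596 isDT_rho596)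
open BIJ88Eq531TranslLawCutoff (measurable_uCut)
open BIJ88Eq5128Split (Cfg UCfg PCfg prevPi Interior)
open BIJ88Eq5128Display (IsDC termMeasure termIntegrand readEntry axialLaw innerMeasure)
open BIJ88Eq5128ScalarSector (RIdx realCoords realCoords_apply inIx sX)
open B2Eq228Conditioning (In Out blkIn)
open BIJ88ExteriorForms5121 (expo523 precK)
open BIJ88ContourSupport536 (Near)
open BIJ88InteriorHaarChart.InteriorChart (treeSet)
open BIJ88FreeCoordinates48 (Emat Emat_mulVec freeBasis)
open BIJ88Eq5127GaugeSector (aOf measurable_aOf abs_aOf_le inIb aIn aOut gW expoBound abs_expo523_le measurable_expo523 measurable_aIn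
  yInt retr lawInt normPrint aIn_glue)
open BIJ88InteriorChartLaw (cset Qm Et Rtt ct eq5128_gauge_torus uCut_gl_idem)
open scoped BigOperators ENNReal Matrix Real
open _root_.MeasureTheory _root_.MeasureTheory.Measure

noncomputable section

attribute [local instance 1001] Subtype.fintype

variable (P : Params) (k : ℕ)

/-! ## §1 The data -/

/-- **the cut-off `Λ_t := T^{(k+1)*}`** — every block variable freed. [cite: BalabanImbrieJaffe1988, (5.3.6) p.280] -/
def ΛU : Unit → Finset (PBond P (k+1)) := fun _ => Finset.univ

/-- **the interior datum**: all unit bonds interior (`Λ^{(k)c*c}_{10} := T₁^{(k)*}`), previous-field interiors `Ip`, scalar interior `Ix` (arbitrary).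
[cite: BalabanImbrieJaffe1988, (5.12.8) p.303] -/
def cD (Ip : (j : Fin k) → Finset (PBond P j)) (Ix : Finset (Balaban1983to89.Site P k)) : Unit → Interior P k :=
  fun _ => ⟨Finset.univ, Ip, Ix⟩

/-- the gauge kernel `T_t := 1` (in place of `∂*σ_{k,loc}∂`). [cite: BalabanImbrieJaffe1988, (5.12.3) p.301] -/
def cT : Unit → Matrix (PBond P k) (PBond P k) ℝ := fun _ => 1

/-- the scalar kernel `M_t(v) := 1` (in place of `Δ_{Λ₁₀}(ũ_{k+1})`) on the real coordinates. [cite: BalabanImbrieJaffe1988, (5.12.2) p.301] -/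
def cM : Unit → GaugeField P (k+1) U1 → Matrix (RIdx P k) (RIdx P k) ℝ := fun _ _ => 1

/-- the window radius and margin `r = ε = 1/(8(d+1)L)`. [cite: BalabanImbrieJaffe1988, (5.9.4) p.297] -/
def rad : ℝ := 1 / (8 * ((P.d : ℝ) + 1) * (P.L : ℝ))

/-- the `ψ`-Gaussian `e^{−½Σ_y|ψ(y)|²}`. [cite: BalabanImbrieJaffe1988, (5.2.8) p.279] -/
def gψ (ψ : HiggsField P (k+1)) : ℂ := ((Real.exp (-(1 / 2) * ∑ y, ‖ψ y‖ ^ 2) : ℝ) : ℂ)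

/-- print's scalar Gaussian `e^{−½⟨φ, Mφ⟩}` with `M = 1`, in real coordinates. [cite: BalabanImbrieJaffe1988, (5.12.2) p.301] -/
def gScalar (φ : HiggsField P k) : ℝ :=
  Real.exp (-(1 / 2 : ℝ) * (realCoords φ ⬝ᵥ ((1 : Matrix (RIdx P k) (RIdx P k) ℝ) *ᵥ realCoords φ)))

variable {P k}

/-- the small-field window `𝟙{|A_b| ≤ r ∀ b ∈ Λ^{c*c}_{10}}` on interior gauge coordinates. [cite: BalabanImbrieJaffe1988, (5.9.4) p.297] -/
def Bwin {D₀ : Interior P k} (r : ℝ) (A : In (inIb D₀) → ℝ) : ℂ := if ∀ b, |A b| ≤ r then 1 else 0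

/-- print's gauge Gaussian (5.12.3) with `T = 1` in the coordinates `A(u)_b = aOf 1 u_b` of a bond field. [cite: BalabanImbrieJaffe1988, (5.12.3) p.301] -/
def gGauge (D₀ : Interior P k) (u : GaugeField P k U1) : ℝ :=
  Real.exp (expo523 (inIb D₀) (1 : Matrix (PBond P k) (PBond P k) ℝ) (fun b => aOf 1 (u b.1)) (fun b => aOf 1 (u b.1)))

variable (P k) in
/-- **the bracket** `J_t({u^{(j)}}, u, v, φ, ψ) := e^{−½Σ|ψ|²} · gGauge(u) · gScalar(φ) · 𝟙{|A(u)_b| ≤ r}`. [cite: BalabanImbrieJaffe1988, (5.9.6) p.297] -/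
def cJ (D : Unit → Interior P k) (r : ℝ) :
    Unit → Prev P k → GaugeField P k U1 → GaugeField P (k+1) U1 → HiggsField P k → HiggsField P (k+1) → ℂ :=
  fun t _ u _ φ ψ => gψ P k ψ * (gGauge (D t) u : ℂ) * (gScalar P k φ : ℂ) * Bwin r (fun b : In (inIb (D t)) => aOf 1 (u b.1))

variable (P k) in
/-- the exterior bracket `X₀ := e^{−½Σ|ψ|²}`. [cite: BalabanImbrieJaffe1988, (5.12.8) p.303] -/
def cX₀ : Unit → Cfg P k → GaugeField P (k+1) U1 → HiggsField P (k+1) → ℂ := fun _ _ _ ψ => gψ P k ψ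

variable (P k) in
/-- the interior bracket `B₀ :=` the window read on the translated interior coordinates `aIn`. [cite: BalabanImbrieJaffe1988, (5.12.8) p.303] -/
def cB₀ (D : Unit → Interior P k) (r : ℝ) : Unit → Cfg P k → GaugeField P (k+1) U1 → HiggsField P (k+1) → ℂ :=
  fun t q _ _ => Bwin r (aIn (ΛU P k) D 1 t q)

/-! ## §2 The kernels: symmetry and positivity -/

/-- a principal block of the identity matrix is positive definite. [cite: BalabanImbrieJaffe1988, (5.12.2) p.301] -/
theorem blkIn_one_posDef {S : Type} [Fintype S] [DecidableEq S] (p : S → Prop) [DecidablePred p] :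
    (blkIn p (1 : Matrix S S ℝ)).PosDef :=
  Matrix.PosDef.one.submatrix Subtype.val_injective

/-- **hypothesis `hK` for `T = 1`, EVERY interior datum and cut-off**: print's precision `Eᵀ T_{in} E` on the free coordinates of the (4.8) constraint
space (`E = Emat`, columns a basis of the free space) is positive definite. [cite: BalabanImbrieJaffe1988, (5.12.3) p.301] -/
theorem precK_one_posDef (D₀ : Interior P k) (Λ₀ : Finset (PBond P (k+1))) :
    (precK (inIb D₀) (1 : Matrix (PBond P k) (PBond P k) ℝ) (Emat (treeSet D₀) (Qm D₀ Λ₀))).PosDef := by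
  have h1 : (blkIn (inIb D₀) (1 : Matrix (PBond P k) (PBond P k) ℝ)).PosDef := blkIn_one_posDef _
  have h2 : Function.Injective (Emat (treeSet D₀) (Qm D₀ Λ₀)).mulVec := by
    intro x y hxy
    have h : Emat (treeSet D₀) (Qm D₀ Λ₀) *ᵥ x = Emat (treeSet D₀) (Qm D₀ Λ₀) *ᵥ y := hxy
    rw [Emat_mulVec, Emat_mulVec] at h
    exact (freeBasis _ _).equivFun.symm.injective (Subtype.val_injective h)
  have h3 := h1.conjTranspose_mul_mul_same h2
  rw [Matrix.conjTranspose_eq_transpose_of_trivial] at h3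
  exact h3

/-! ## §3 The numerics -/

/-- `r = ε = 1/(8(d+1)L) > 0`. [cite: BalabanImbrieJaffe1988, (5.9.4) p.297] -/
theorem rad_pos : 0 < rad P := by
  have hL : (0 : ℝ) < P.L := Nat.cast_pos.mpr P.L_pos
  unfold rad
  positivity

/-- **hypothesis `hnum`**: `2(d+1)L·e_k(r + ε) = ½ < π`. [cite: BalabanImbrieJaffe1988, (5.12.4) p.301] -/
theorem hnum_cert : 2 * ((P.d : ℝ) + 1) * P.L * (1 * (rad P + rad P)) < π := by
  have hL : (0 : ℝ) < P.L := Nat.cast_pos.mpr P.L_pos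
  have hd : (0 : ℝ) < (P.d : ℝ) + 1 := by positivity
  have h : 2 * ((P.d : ℝ) + 1) * P.L * (1 * (rad P + rad P)) = 1 / 2 := by
    unfold rad
    field_simp
    ring
  rw [h]
  linarith [Real.pi_gt_three]

/-! ## §4 The bracket: Gaussians, the bounded gauge factor, integrability, the interior bracket -/

/-- `⟨realCoords φ, 1·realCoords φ⟩ = Σ_x|φ(x)|²`, so `gScalar φ = e^{−½Σ_x|φ(x)|²}`. [cite: BalabanImbrieJaffe1988, (5.12.2) p.301] -/
theorem gScalar_eq (φ : HiggsField P k) : gScalar P k φ = Real.exp (-(1 / 2) * ∑ x, ‖φ x‖ ^ 2) := by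
  unfold gScalar
  congr 2
  rw [Matrix.one_mulVec]
  simp only [dotProduct, Fintype.sum_prod_type, realCoords_apply, Fin.sum_univ_two, Matrix.cons_val_zero, Matrix.cons_val_one,
    Matrix.cons_val_fin_one, Complex.sq_norm, Complex.normSq_apply]

/-- the one-site complex Gaussian `e^{−½|z|²}` is `d²z`-integrable (its integral is `2π ≠ 0`). [folklore] -/
private theorem integrable_cgauss_site : Integrable (fun z : ℂ => Real.exp (-(1 / 2) * ‖z‖ ^ 2)) := by
  refine Integrable.of_integral_ne_zero ?_
  rw [GaussianFourier.integral_rexp_neg_mul_sq_norm (by norm_num : (0 : ℝ) < 1 / 2)]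
  positivity

/-- the product Gaussian `e^{−½Σ_x|φ(x)|²}` is `𝒟φ`-integrable on any lattice. [folklore] -/
private theorem integrable_gaussC (j : ℕ) :
    Integrable (fun φ : HiggsField P j => ((Real.exp (-(1 / 2) * ∑ x, ‖φ x‖ ^ 2) : ℝ) : ℂ)) := by
  have h1 : Integrable (fun φ : HiggsField P j => ∏ x, Real.exp (-(1 / 2) * ‖φ x‖ ^ 2)) :=
    Integrable.fintype_prod (f := fun (_ : Balaban1983to89.Site P j) (z : ℂ) => Real.exp (-(1 / 2) * ‖z‖ ^ 2))
      fun _ => integrable_cgauss_site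
  have h2 : (fun φ : HiggsField P j => ((Real.exp (-(1 / 2) * ∑ x, ‖φ x‖ ^ 2) : ℝ) : ℂ)) =
      fun φ => ((∏ x, Real.exp (-(1 / 2) * ‖φ x‖ ^ 2) : ℝ) : ℂ) := by
    funext φ
    rw [Finset.mul_sum, Real.exp_sum]
  rw [h2]
  exact h1.ofReal

/-- the `ψ`-Gaussian is `dψ`-integrable. [cite: BalabanImbrieJaffe1988, (5.2.8) p.279] -/
theorem integrable_gψ : Integrable (gψ P k) := integrable_gaussC (k+1)

/-- print's scalar Gaussian with `M = 1` is `𝒟φ`-integrable. [cite: BalabanImbrieJaffe1988, (5.12.2) p.301] -/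
theorem integrable_gScalarC : Integrable (fun φ : HiggsField P k => ((gScalar P k φ : ℝ) : ℂ)) := by
  have h : (fun φ : HiggsField P k => ((gScalar P k φ : ℝ) : ℂ)) = fun φ => ((Real.exp (-(1 / 2) * ∑ x, ‖φ x‖ ^ 2) : ℝ) : ℂ) :=
    funext fun φ => by rw [gScalar_eq]
  rw [h]
  exact integrable_gaussC k

/-- kernel: the interior coordinates of the translated field are measurable in the unit-lattice field. [cite: BalabanImbrieJaffe1988, (5.12.3) p.301] -/
theorem measurable_coordIn (D₀ : Interior P k) (Λ₀ : Finset (PBond P (k+1))) :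
    Measurable fun U : GaugeField P k U1 => fun b : In (inIb D₀) => aOf 1 (uCut qU Λ₀ U b.1) :=
  measurable_pi_lambda _ fun b => (measurable_aOf 1).comp ((measurable_pi_apply b.1).comp (measurable_uCut Λ₀))

/-- kernel: the exterior coordinates likewise. [cite: BalabanImbrieJaffe1988, (5.12.3) p.301] -/
theorem measurable_coordOut (D₀ : Interior P k) (Λ₀ : Finset (PBond P (k+1))) :
    Measurable fun U : GaugeField P k U1 => fun b : Out (inIb D₀) => aOf 1 (uCut qU Λ₀ U b.1) :=
  measurable_pi_lambda _ fun b => (measurable_aOf 1).comp ((measurable_pi_apply b.1).comp (measurable_uCut Λ₀))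

/-- **the gauge factor is bounded**: `0 < gGauge ≤ exp(expoBound)` (every coordinate is `≤ π` in absolute value; p34 g12's `abs_expo523_le`).
[cite: BalabanImbrieJaffe1988, (5.12.3) p.301] -/
theorem gGauge_le (D₀ : Interior P k) (u : GaugeField P k U1) :
    gGauge D₀ u ≤ Real.exp (expoBound (inIb D₀) (1 : Matrix (PBond P k) (PBond P k) ℝ) 1) := by
  unfold gGauge
  exact Real.exp_le_exp.mpr ((le_abs_self _).trans
    (abs_expo523_le _ _ one_pos (fun _ => abs_aOf_le one_pos _) (fun _ => abs_aOf_le one_pos _)))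

/-- the window is bounded by `1`. [cite: BalabanImbrieJaffe1988, (5.9.4) p.297] -/
theorem norm_Bwin_le {D₀ : Interior P k} (r : ℝ) (A : In (inIb D₀) → ℝ) : ‖Bwin r A‖ ≤ 1 := by
  unfold Bwin
  split_ifs <;> simp

/-- kernel: the window set is measurable in the coordinates. [cite: BalabanImbrieJaffe1988, (5.9.4) p.297] -/
theorem measurableSet_win {D₀ : Interior P k} (r : ℝ) : MeasurableSet {A : In (inIb D₀) → ℝ | ∀ b, |A b| ≤ r} := by
  have h : {A : In (inIb D₀) → ℝ | ∀ b, |A b| ≤ r} = ⋂ b, {A | |A b| ≤ r} := by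
    ext A; simp
  rw [h]
  exact MeasurableSet.iInter fun b => measurableSet_le (continuous_abs.measurable.comp (measurable_pi_apply b)) measurable_const

/-- kernel: the window is measurable in the coordinates. [cite: BalabanImbrieJaffe1988, (5.9.4) p.297] -/
theorem measurable_Bwin {D₀ : Interior P k} (r : ℝ) : Measurable fun A : In (inIb D₀) → ℝ => Bwin r A := by
  unfold Bwin
  exact Measurable.ite (measurableSet_win r) measurable_const measurable_const

/-- **the `u`-factor of the bracket, read on the translated field, is integrable for EVERY finite `u`-law** (bounded and measurable).
[cite: BalabanImbrieJaffe1988, (5.12.3) p.301] -/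
theorem integrable_uFactor (D : Unit → Interior P k) (r : ℝ) (t : Unit) (Λ₀ : Finset (PBond P (k+1)))
    (ν : Measure (GaugeField P k U1)) [IsFiniteMeasure ν] :
    Integrable (fun U : GaugeField P k U1 => ((gGauge (D t) (uCut qU Λ₀ U) : ℝ) : ℂ) *
      Bwin r (fun b : In (inIb (D t)) => aOf 1 (uCut qU Λ₀ U b.1))) ν := by
  have hm1 : Measurable fun U : GaugeField P k U1 => ((gGauge (D t) (uCut qU Λ₀ U) : ℝ) : ℂ) := by
    refine Complex.measurable_ofReal.comp ?_
    unfold gGauge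
    exact Real.measurable_exp.comp (measurable_expo523 _ _ (measurable_coordIn (D t) Λ₀) (measurable_coordOut (D t) Λ₀))
  have hm2 : Measurable fun U : GaugeField P k U1 => Bwin r (fun b : In (inIb (D t)) => aOf 1 (uCut qU Λ₀ U b.1)) :=
    (measurable_Bwin r).comp (measurable_coordIn (D t) Λ₀)
  refine (integrable_const (Real.exp (expoBound (inIb (D t)) (1 : Matrix (PBond P k) (PBond P k) ℝ) 1))).mono'
    (hm1.mul hm2).aestronglyMeasurable (ae_of_all _ fun U => ?_)
  have h1 := gGauge_le (D t) (uCut qU Λ₀ U)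
  have h2 := norm_Bwin_le r (fun b : In (inIb (D t)) => aOf 1 (uCut qU Λ₀ U b.1))
  have h0 : 0 ≤ gGauge (D t) (uCut qU Λ₀ U) := by unfold gGauge; positivity
  rw [norm_mul, Complex.norm_real, Real.norm_eq_abs, abs_of_nonneg h0]
  nlinarith [norm_nonneg (Bwin r (fun b : In (inIb (D t)) => aOf 1 (uCut qU Λ₀ U b.1)))]

/-- **hypothesis `hJ₂` of gen 9's `isDT_rho596`**: the bracket is integrable on the configurations of the term over `∫𝒟u δ_{Ax} ⊗ Π𝒟u^{(j)} ⊗ 𝒟φ ⊗ dψ`.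
[cite: BalabanImbrieJaffe1988, (5.9.6) p.297] -/
theorem integrable_fields (D : Unit → Interior P k) (r : ℝ) (t : Unit) :
    Integrable (fun q : Fields P k => cJ P k D r t q.2.1 (uCut qU (ΛU P k t) q.1) (qU q.1) q.2.2.1 q.2.2.2)
      (fieldsMeasure (axialMeasure P k U1)) := by
  have h := (integrable_uFactor D r t (ΛU P k t) (axialMeasure P k U1)).mul_prod
    ((integrable_const (1 : ℂ) (μ := prevMeasure P k)).mul_prod
      ((integrable_gScalarC (P := P) (k := k)).mul_prod (integrable_gψ (P := P) (k := k))))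
  refine h.congr (ae_of_all _ fun q => ?_)
  simp only [cJ]
  ring

/-- **hypothesis `hJi` of `eq5128_gauge_torus`**: the bracket read on the product space is integrable against the term measure
`𝒟v′ ⊗ Π_b axialLaw_b ⊗ Π𝒟u^{(j)} ⊗ dψ ⊗ 𝒟φ`. [cite: BalabanImbrieJaffe1988, (5.9.6) p.297] -/
theorem integrable_term (D : Unit → Interior P k) (r : ℝ) (t : Unit) :
    Integrable (termIntegrand (ΛU P k) qU (cJ P k D r) t) (termMeasure (Measure.pi (axialLaw P k))) := by
  -- the product of the one-bond laws is a finite measure (instance stated on the `GaugeField` carrier of `integrable_uFactor`)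
  have hfin : @IsFiniteMeasure (GaugeField P k U1) (inferInstance : MeasurableSpace (GaugeField P k U1)) (Measure.pi (axialLaw P k)) :=
    ⟨measure_lt_top (Measure.pi (axialLaw P k)) Set.univ⟩
  have h := (integrable_const (1 : ℂ) (μ := fieldMeasure P (k+1) U1)).mul_prod
    ((@integrable_uFactor P k D r t (ΛU P k t) (Measure.pi (axialLaw P k)) hfin).mul_prod
      ((integrable_const (1 : ℂ) (μ := prevPi P k)).mul_prod
        ((integrable_gψ (P := P) (k := k)).mul_prod (integrable_gScalarC (P := P) (k := k)))))
  refine h.congr (ae_of_all _ fun q => ?_)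
  simp only [termIntegrand, cJ]
  ring

/-- **hypothesis `hBm`**: the interior bracket is measurable in the configuration. [cite: BalabanImbrieJaffe1988, (5.12.8) p.303] -/
theorem measurable_cB₀ (D : Unit → Interior P k) (r : ℝ) (t : Unit) (v' : GaugeField P (k+1) U1) (ψ : HiggsField P (k+1)) :
    Measurable fun q => cB₀ P k D r t q v' ψ := by
  unfold cB₀
  exact (measurable_Bwin r).comp (measurable_aIn t)

/-- **hypothesis `hBretr` BY NAME**: the interior bracket at a glued configuration is unchanged under the retraction (p34 g12's `aIn_glue`: the
interior coordinates at a glued configuration are those of the translated interior variables; `uCut_gl_idem`: the translation is idempotent on the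
interior, first fat-interior compatibility — trivial here — and standing range). [cite: BalabanImbrieJaffe1988, (5.12.4) p.301] -/
theorem cB₀_retr (hk : k + 1 ≤ P.m + P.K) (D : Unit → Interior P k)
    (hfat : ∀ t, ∀ b ∈ (D t).Ib, ∀ b', IsCross b → IsCross b' → coarse b' = coarse b → coarse b ∈ ΛU P k t → b' ∈ (D t).Ib)
    (r : ℝ) (t : Unit) (e : (D t).Ext) (i : (D t).Int) (v' : GaugeField P (k+1) U1) (ψ : HiggsField P (k+1)) :
    cB₀ P k D r t ((D t).glue e i) v' ψ = cB₀ P k D r t ((D t).glue e (retr (ΛU P k) D t e i)) v' ψ := by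
  have hidem : yInt (ΛU P k) D t e (yInt (ΛU P k) D t e i.1) = yInt (ΛU P k) D t e i.1 := uCut_gl_idem hk (hfat t) e i.1
  unfold cB₀
  rw [aIn_glue, aIn_glue]
  simp only [retr]
  rw [hidem]

/-- **hypothesis `hBwin`**: where the interior bracket is nonzero, the window holds. [cite: BalabanImbrieJaffe1988, (5.9.4) p.297] -/
theorem cB₀_win (D : Unit → Interior P k) (r : ℝ) (t : Unit) (q : Cfg P k) (v' : GaugeField P (k+1) U1) (ψ : HiggsField P (k+1))
    (h : cB₀ P k D r t q v' ψ ≠ 0) : ∀ b, |aIn (ΛU P k) D 1 t q b| ≤ r := by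
  by_contra hb
  refine h ?_
  unfold cB₀ Bwin
  rw [if_neg hb]

/-! ## §5 The certificate -/

/-- the first fat-interior compatibility for the all-bonds interior (trivial). [cite: BalabanImbrieJaffe1988, (3.5) p.266] -/
theorem cD_hfat (Ip : (j : Fin k) → Finset (PBond P j)) (Ix : Finset (Balaban1983to89.Site P k)) :
    ∀ t, ∀ b ∈ (cD P k Ip Ix t).Ib, ∀ b', IsCross b → IsCross b' → coarse b' = coarse b → coarse b ∈ ΛU P k t → b' ∈ (cD P k Ip Ix t).Ib :=
  fun _ _ _ b' _ _ _ _ => Finset.mem_univ b'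

/-- the second fat-interior compatibility for the all-bonds interior (no exterior bond). [cite: BalabanImbrieJaffe1988, (3.5) p.266] -/
theorem cD_hfat' (Ip : (j : Fin k) → Finset (PBond P j)) (Ix : Finset (Balaban1983to89.Site P k)) :
    ∀ t, ∀ b', b' ∉ (cD P k Ip Ix t).Ib → IsCross b' → coarse b' ∈ ΛU P k t → ∀ b, Near (coarse b') b → b ∉ (cD P k Ip Ix t).Ib :=
  fun _ b' hb' _ _ _ _ => absurd (Finset.mem_univ b') hb'

/-- the constrained block bonds of the datum (`δ(QA)` of (4.8)/(5.12.3)): exactly the coarse bonds of the crossing unit bonds.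
[cite: BalabanImbrieJaffe1988, (4.8) p.275] -/
theorem mem_cset_cD (Ip : (j : Fin k) → Finset (PBond P j)) (Ix : Finset (Balaban1983to89.Site P k)) (t : Unit) (c : PBond P (k+1)) :
    c ∈ cset (cD P k Ip Ix t) (ΛU P k t) ↔ ∃ b : PBond P k, IsCross b ∧ coarse b = c := by
  rw [BIJ88InteriorChartLaw.mem_cset]
  simp [cD, ΛU]

/-- **KERNEL NON-VACUITY CERTIFICATE FOR `eq5128_gauge_torus`.**  For every torus `P`, every step `k` of the standing range and every choice of
the previous-field interiors `Ip` and the scalar interior `Ix`, the conclusion of `BIJ88InteriorChartLaw.eq5128_gauge_torus` — the display (5.12.8)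
`IsDC` with print's exterior normaliser and the (5.12.7) interior law — holds for the data of §1, obtained by APPLYING `eq5128_gauge_torus` with
all of its hypotheses discharged by the kernel: the (5.9.6) input (gen 9's `isDT_rho596` with `integrable_fields`), `hek`/`hr0`/`hε`/`hnum`
(`rad_pos`, `hnum_cert`), `hfat`/`hfat'` (`cD_hfat`, `cD_hfat'`), `hT`/`hMs` (`Matrix.isSymm_one`), `hK` (`precK_one_posDef`), `hMpd`
(`blkIn_one_posDef`), `hMm`, the readings `hv` (every block bond is cut off), `hX₀` (rfl), `hJ` (rfl: the bracket read on a configuration IS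
`X₀ · gW · e^{−½⟨realCoords φ, M realCoords φ⟩} · B₀`), `hBm`/`hBretr`/`hBwin` (`measurable_cB₀`, `cB₀_retr`, `cB₀_win`), `hXsmall` (no exterior
bond), `hJi` (`integrable_term`).  Every binder is inhabited (one term; window radius `r > 0`; constrained block bonds `mem_cset_cD`).
[cite: BalabanImbrieJaffe1988, (5.12.8) p.303] -/
theorem eq5128_gauge_torus_nonvacuous (hk : k + 1 ≤ P.m + P.K) (Ip : (j : Fin k) → Finset (PBond P j))
    (Ix : Finset (Balaban1983to89.Site P k)) :
    IsDC {()} (ΛU P k) qU (fun t => (cD P k Ip Ix t).extMeasure (axialLaw P k))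
      (fun t q v' ψ => cX₀ P k t q v' ψ * (sX (ΛU P k) qU (cD P k Ip Ix) (cM P k) t q v' : ℂ) *
        (normPrint (ΛU P k) (cD P k Ip Ix) 1 (cT P k) (cM P k) (Et (ΛU P k) (cD P k Ip Ix)) (Rtt (ΛU P k) (cD P k Ip Ix))
          (ct (ΛU P k) (cD P k Ip Ix) 1 hk (cD_hfat Ip Ix)) t (((cD P k Ip Ix) t).split q).1 v' : ℂ))
      (fun t q v' _ => ((cD P k Ip Ix) t).fibreMeasure
        (lawInt (ΛU P k) (cD P k Ip Ix) 1 (cT P k) (cM P k) (Et (ΛU P k) (cD P k Ip Ix)) (Rtt (ΛU P k) (cD P k Ip Ix)) (rad P) t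
          (((cD P k Ip Ix) t).split q).1 v') (((cD P k Ip Ix) t).split q).1)
      (cB₀ P k (cD P k Ip Ix) (rad P)) (rho596 {()} (ΛU P k) (cJ P k (cD P k Ip Ix) (rad P))) :=
  eq5128_gauge_torus (Λ := ΛU P k) (D := cD P k Ip Ix) (ek := 1) (T := cT P k) (M := cM P k) (r := rad P) hk
    (isDT_rho596 hk fun t _ => integrable_fields (cD P k Ip Ix) (rad P) t) one_pos (rad_pos (P := P)).le (rad_pos (P := P)) (hnum_cert (P := P))
    (cD_hfat Ip Ix) (cD_hfat' Ip Ix) (fun _ => Matrix.isSymm_one) (fun t => precK_one_posDef (cD P k Ip Ix t) (ΛU P k t))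
    (fun _ _ => Matrix.isSymm_one) (fun t _ => blkIn_one_posDef (inIx (cD P k Ip Ix t))) (fun _ _ _ => measurable_const)
    (cX₀ P k) (cB₀ P k (cD P k Ip Ix) (rad P))
    (fun t _ q v' => by funext c; simp [vCut_apply, ΛU])
    (fun _ _ _ _ _ => rfl) (fun _ _ _ _ _ => rfl)
    (fun t v' ψ => measurable_cB₀ (cD P k Ip Ix) (rad P) t v' ψ)
    (fun t _ e i v' ψ => cB₀_retr hk (cD P k Ip Ix) (cD_hfat Ip Ix) (rad P) t e i v' ψ)
    (fun t _ q v' ψ hne => cB₀_win (cD P k Ip Ix) (rad P) t q v' ψ hne)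
    (fun _ _ _ _ _ _ _ _ b hb _ => absurd (Finset.mem_univ b) hb)
    (fun t _ => integrable_term (cD P k Ip Ix) (rad P) t)

/-! ## §6 (v1.1, append-only) Non-degeneracy of the data — the owner's criteria N1–N5 (ROWS-C2-part2 v2.181) -/

section NonDegeneracy

open BIJ88FreeCount48 (crossBond isCross_crossBond coarse_crossBond)
open BIJ88Eq5127GaugeSector (win box affChart HChart measurable_yInt measurable_affChart)
open BIJ88InteriorChartLaw (hChart)

variable (Ip : (j : Fin k) → Finset (PBond P j)) (Ix : Finset (Balaban1983to89.Site P k))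

/-- **(N1)** one term. [cite: BalabanImbrieJaffe1988, (5.12.8) p.303] -/
theorem terms_nonempty : (({()} : Finset Unit)).Nonempty := Finset.singleton_nonempty _

/-- **(N3)** the constrained block bonds are ALL block bonds: every block bond `c` is the coarse bond of r18's crossing bond `crossBond c`
(standing range). [cite: BalabanImbrieJaffe1988, (4.8) p.275] -/
theorem cset_cD_eq_univ (hk : k + 1 ≤ P.m + P.K) (t : Unit) : cset (cD P k Ip Ix t) (ΛU P k t) = Finset.univ := by
  ext c
  simp only [Finset.mem_univ, iff_true]
  rw [mem_cset_cD]
  exact ⟨crossBond c, isCross_crossBond hk c, coarse_crossBond hk c⟩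

/-- **(N3)** the gauge interior is nonempty (it is everything; a crossing bond exists over any block bond). [cite: BalabanImbrieJaffe1988, (5.12.8) p.303] -/
theorem ib_cD_nonempty (t : Unit) (c : PBond P (k+1)) : (cD P k Ip Ix t).Ib.Nonempty := ⟨crossBond c, Finset.mem_univ _⟩

/-- **(N4)** the scalar kernel is positive definite on the whole real coordinate space (so on every interior block, `blkIn_one_posDef`).
[cite: BalabanImbrieJaffe1988, (5.12.2) p.301] -/
theorem cM_posDef (t : Unit) (v : GaugeField P (k+1) U1) : (cM P k t v).PosDef := Matrix.PosDef.one

/-- **(N2)** the exterior bracket is nowhere zero. [cite: BalabanImbrieJaffe1988, (5.12.8) p.303] -/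
theorem cX₀_ne_zero (t : Unit) (q : Cfg P k) (v' : GaugeField P (k+1) U1) (ψ : HiggsField P (k+1)) : cX₀ P k t q v' ψ ≠ 0 := by
  simp only [cX₀, gψ, ne_eq, Complex.ofReal_eq_zero]
  exact (Real.exp_pos _).ne'

/-- **(N5)** the chart constant `c_t = (e_k/2π)^{‖Λ‖}·J_t` is strictly positive (`jac_pos`). [cite: BalabanImbrieJaffe1988, (5.12.3) p.301] -/
theorem ct_cD_pos (hk : k + 1 ≤ P.m + P.K) (t : Unit) : 0 < ct (ΛU P k) (cD P k Ip Ix) 1 hk (cD_hfat Ip Ix) t := by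
  unfold ct
  exact mul_pos (pow_pos (by positivity) _) (NNReal.coe_pos.2 (BIJ88FreeCoordinates48.jac_pos _))

/-- the unwrapped box contains a ball around `0` (no exterior coordinates: the offset `R·a` vanishes; `E` is a finite matrix).
[cite: BalabanImbrieJaffe1988, (5.9.4) p.297] -/
theorem ball_subset_box (t : Unit) (e : (cD P k Ip Ix t).Ext) :
    ∃ ρ > 0, Metric.ball 0 ρ ⊆ box (ΛU P k) (cD P k Ip Ix) 1 (Et (ΛU P k) (cD P k Ip Ix)) (Rtt (ΛU P k) (cD P k Ip Ix)) (rad P) t e := by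
  haveI : IsEmpty (Out (inIb (cD P k Ip Ix t))) := ⟨fun b => b.2 (Finset.mem_univ _)⟩
  set E := Et (ΛU P k) (cD P k Ip Ix) t with hE
  set K : ℝ := ∑ b, ∑ i, |E b i| with hK
  have hK0 : 0 ≤ K := Finset.sum_nonneg fun b _ => Finset.sum_nonneg fun i _ => abs_nonneg _
  have hr := rad_pos (P := P)
  refine ⟨rad P / (K + 1), div_pos hr (by linarith), fun x hx => ?_⟩
  rw [Metric.mem_ball, dist_zero_right] at hx
  intro b
  have hR : (Rtt (ΛU P k) (cD P k Ip Ix) t *ᵥ aOut (ΛU P k) (cD P k Ip Ix) 1 t ((cD P k Ip Ix t).glue e (cD P k Ip Ix t).base)) b = 0 := by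
    simp [Matrix.mulVec, dotProduct]
  rw [Pi.sub_apply, hR, sub_zero]
  have hrow : |(E *ᵥ x) b| ≤ K * ‖x‖ := by
    calc |(E *ᵥ x) b| = |∑ i, E b i * x i| := rfl
      _ ≤ ∑ i, |E b i * x i| := Finset.abs_sum_le_sum_abs _ _
      _ ≤ ∑ i, |E b i| * ‖x‖ := Finset.sum_le_sum fun i _ => by
          rw [abs_mul]
          exact mul_le_mul_of_nonneg_left (by rw [← Real.norm_eq_abs]; exact norm_le_pi_norm x i) (abs_nonneg _)
      _ = (∑ i, |E b i|) * ‖x‖ := by rw [Finset.sum_mul]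
      _ ≤ K * ‖x‖ := mul_le_mul_of_nonneg_right
          (Finset.single_le_sum (f := fun b => ∑ i, |E b i|) (fun _ _ => Finset.sum_nonneg fun _ _ => abs_nonneg _) (Finset.mem_univ b))
          (norm_nonneg _)
  have h2 : K * ‖x‖ ≤ K * (rad P / (K + 1)) := mul_le_mul_of_nonneg_left hx.le hK0
  have h3 : K * (rad P / (K + 1)) ≤ rad P := by
    rw [mul_div_assoc', div_le_iff₀ (by linarith)]
    nlinarith
  exact hrow.trans (h2.trans h3)

/-- the unwrapped box has positive Lebesgue measure. [cite: BalabanImbrieJaffe1988, (5.9.4) p.297] -/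
theorem volume_box_pos (t : Unit) (e : (cD P k Ip Ix t).Ext) :
    0 < volume (box (ΛU P k) (cD P k Ip Ix) 1 (Et (ΛU P k) (cD P k Ip Ix)) (Rtt (ΛU P k) (cD P k Ip Ix)) (rad P) t e) := by
  obtain ⟨ρ, hρ, hsub⟩ := ball_subset_box Ip Ix t e
  exact (Metric.measure_ball_pos volume _ hρ).trans_le (measure_mono hsub)

/-- **(N2) THE WINDOW EVENT HAS POSITIVE INTERIOR MEASURE, FOR EVERY EXTERIOR CONFIGURATION** — under the interior one-bond laws
`Π_{b∈Λ^{c*c}_{10}} axialLaw_b`, the translated interior gauge variables land in the window `{|A_b| ≤ r ∀b}` with probability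
`c_t · vol(box) > 0`: p34 g12's chart law `hChart` (HChart) BY NAME, evaluated on the whole space, with `ct_cD_pos` and `volume_box_pos`.
[cite: BalabanImbrieJaffe1988, (5.12.3) p.301] -/
theorem measure_win_pos (hk : k + 1 ≤ P.m + P.K) (t : Unit) (e : (cD P k Ip Ix t).Ext) :
    0 < (cD P k Ip Ix t).μIU (axialLaw P k) (yInt (ΛU P k) (cD P k Ip Ix) t e ⁻¹' win (D := cD P k Ip Ix) (1 : ℝ) (rad P) t) := by
  have H := hChart (Λ := ΛU P k) (D := cD P k Ip Ix) (ek := (1 : ℝ)) hk one_pos (rad_pos (P := P)).le (rad_pos (P := P))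
    (hnum_cert (P := P)) (cD_hfat Ip Ix) t e (fun _ _ b hb _ => absurd (Finset.mem_univ b) hb)
  unfold HChart at H
  have H1 := congrArg (fun μ => μ Set.univ) H
  rw [Measure.restrict_apply MeasurableSet.univ, Set.univ_inter, Measure.map_apply (measurable_yInt t e) (BIJ88Eq5127GaugeSector.measurableSet_win t),
    Measure.smul_apply, Measure.map_apply (measurable_affChart t e) MeasurableSet.univ, Set.preimage_univ, Measure.restrict_apply_univ,
    smul_eq_mul] at H1
  rw [H1]
  exact ENNReal.mul_pos (ENNReal.ofReal_pos.2 (ct_cD_pos Ip Ix hk t)).ne' (volume_box_pos Ip Ix t e).ne'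

/-- on the window event the interior bracket is `1` at the glued configuration (any previous/scalar interior values).
[cite: BalabanImbrieJaffe1988, (5.12.8) p.303] -/
theorem cB₀_glue_eq_one {t : Unit} {e : (cD P k Ip Ix t).Ext} {i₁ : (cD P k Ip Ix t).IU}
    (h : yInt (ΛU P k) (cD P k Ip Ix) t e i₁ ∈ win (D := cD P k Ip Ix) (1 : ℝ) (rad P) t)
    (rest : (cD P k Ip Ix t).IP × (cD P k Ip Ix t).IX) (v' : GaugeField P (k+1) U1) (ψ : HiggsField P (k+1)) :
    cB₀ P k (cD P k Ip Ix) (rad P) t ((cD P k Ip Ix t).glue e (i₁, rest)) v' ψ = 1 := by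
  unfold cB₀
  rw [aIn_glue]
  exact if_pos h

/-- **(N2) THE INTERIOR BRACKET IS `1` ON A SET OF POSITIVE INTERIOR MEASURE** (hence not identically zero, and the premise of `hBwin` is met
there): for every exterior configuration and all previous/scalar interior values. [cite: BalabanImbrieJaffe1988, (5.12.8) p.303] -/
theorem measure_cB₀_eq_one_pos (hk : k + 1 ≤ P.m + P.K) (t : Unit) (e : (cD P k Ip Ix t).Ext)
    (rest : (cD P k Ip Ix t).IP × (cD P k Ip Ix t).IX) (v' : GaugeField P (k+1) U1) (ψ : HiggsField P (k+1)) :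
    0 < (cD P k Ip Ix t).μIU (axialLaw P k) {i₁ | cB₀ P k (cD P k Ip Ix) (rad P) t ((cD P k Ip Ix t).glue e (i₁, rest)) v' ψ = 1} :=
  (measure_win_pos Ip Ix hk t e).trans_le (measure_mono fun _ hi => cB₀_glue_eq_one Ip Ix hi rest v' ψ)

end NonDegeneracy

/-! ## §7 (v1.1, append-only) The output density `ρ^L_{k+1}` is not almost everywhere zero (N2, third clause) -/

section Output

open BIJ88Eq596Display (integral_eq_of_isDT)
open BIJ88Eq5127GaugeSector (win)

variable (Ip : (j : Fin k) → Finset (PBond P j)) (Ix : Finset (Balaban1983to89.Site P k))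

variable (P k) in
/-- the window event on the unit-lattice gauge fields: all translated coordinates in the window. [cite: BalabanImbrieJaffe1988, (5.9.4) p.297] -/
def Wset (t : Unit) : Set (GaugeField P k U1) := {U | ∀ b, |aOf 1 (uCut qU (ΛU P k t) U b)| ≤ rad P}

/-- **THE WINDOW EVENT HAS POSITIVE `∫𝒟u δ_{Ax}`-MEASURE** — `measure_win_pos` transported along the exterior/interior split of p34 g12's
`BIJ88Eq5128Split` (all bonds interior: the exterior gauge factor is a one-point space; `measurePreserving_splitU`).
[cite: BalabanImbrieJaffe1988, (5.12.3) p.301] -/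
theorem axialMeasure_Wset_pos (hk : k + 1 ≤ P.m + P.K) (t : Unit) : 0 < axialMeasure P k U1 (Wset P k t) := by
  let Ip₀ : (j : Fin k) → Finset (PBond P j) := fun _ => ∅
  let Ix₀ : Finset (Balaban1983to89.Site P k) := ∅
  haveI hE : IsEmpty {b : PBond P k // b ∉ (cD P k Ip₀ Ix₀ t).Ib} := ⟨fun b => b.2 (Finset.mem_univ _)⟩
  let e : (cD P k Ip₀ Ix₀ t).Ext := (fun b => isEmptyElim b, (fun _ _ => 1, fun _ => 0))
  have hmp := (cD P k Ip₀ Ix₀ t).measurePreserving_splitU (axialLaw P k)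
  have hg : ∀ U : UCfg P k,
      ((cD P k Ip₀ Ix₀ t).glue e (((cD P k Ip₀ Ix₀ t).splitU U).2, (cD P k Ip₀ Ix₀ t).base.2)).1 = U := by
    intro U
    funext b
    rw [BIJ88Eq5128Split.Interior.glue_fst_of_mem _ _ _ (Finset.mem_univ b)]
    exact (cD P k Ip₀ Ix₀ t).splitU_snd U ⟨b, Finset.mem_univ b⟩
  -- the window event of §6, read through the split, as an event on the unit-lattice configurations
  let W' : Set (UCfg P k) := (cD P k Ip₀ Ix₀ t).splitU ⁻¹'
    (Set.univ ×ˢ (yInt (ΛU P k) (cD P k Ip₀ Ix₀) t e ⁻¹' win (D := cD P k Ip₀ Ix₀) (1 : ℝ) (rad P) t))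
  haveI : IsProbabilityMeasure ((cD P k Ip₀ Ix₀ t).μEU (axialLaw P k)) := by
    unfold BIJ88Eq5128Split.Interior.μEU; infer_instance
  have hA : 0 < Measure.pi (axialLaw P k) W' := by
    show 0 < Measure.pi (axialLaw P k) ((cD P k Ip₀ Ix₀ t).splitU ⁻¹'
      (Set.univ ×ˢ (yInt (ΛU P k) (cD P k Ip₀ Ix₀) t e ⁻¹' win (D := cD P k Ip₀ Ix₀) (1 : ℝ) (rad P) t)))
    rw [hmp.measure_preimage_equiv, Measure.prod_prod, measure_univ, one_mul]
    exact measure_win_pos Ip₀ Ix₀ hk t e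
  have hB : 0 < axialMeasure P k U1 W' := by
    rw [← BIJ88Eq5128Display.axialMeasure_eq_pi_axialLaw] at hA
    exact hA
  have hsub : W' ⊆ Wset P k t := by
    intro U hU
    have h2 : ∀ b : {b // b ∈ (cD P k Ip₀ Ix₀ t).Ib},
        |aOf 1 (uCut qU (ΛU P k t) ((cD P k Ip₀ Ix₀ t).glue e (((cD P k Ip₀ Ix₀ t).splitU U).2, (cD P k Ip₀ Ix₀ t).base.2)).1 b.1)|
          ≤ rad P := (Set.mem_prod.1 (Set.mem_preimage.1 hU)).2
    change ∀ b, |aOf 1 (uCut qU (ΛU P k t) U b)| ≤ rad P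
    intro b
    have h3 := h2 ⟨b, Finset.mem_univ b⟩
    rwa [hg U] at h3
  exact hB.trans_le (measure_mono hsub)

/-- the `u`-factor of the bracket as a real function of the unit-lattice field. [cite: BalabanImbrieJaffe1988, (5.12.3) p.301] -/
def uR (t : Unit) (U : GaugeField P k U1) : ℝ :=
  gGauge (cD P k Ip Ix t) (uCut qU (ΛU P k t) U) *
    (if ∀ b : In (inIb (cD P k Ip Ix t)), |aOf 1 (uCut qU (ΛU P k t) U b.1)| ≤ rad P then 1 else 0)

/-- the complex `u`-factor of `cJ` is the real one. [cite: BalabanImbrieJaffe1988, (5.12.3) p.301] -/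
theorem uC_eq_uR (t : Unit) (U : GaugeField P k U1) :
    ((gGauge (cD P k Ip Ix t) (uCut qU (ΛU P k t) U) : ℝ) : ℂ) *
        Bwin (rad P) (fun b : In (inIb (cD P k Ip Ix t)) => aOf 1 (uCut qU (ΛU P k t) U b.1))
      = ((uR Ip Ix t U : ℝ) : ℂ) := by
  unfold uR Bwin
  split_ifs <;> simp

/-- `uR ≥ 0`. [cite: BalabanImbrieJaffe1988, (5.12.3) p.301] -/
theorem uR_nonneg (t : Unit) (U : GaugeField P k U1) : 0 ≤ uR Ip Ix t U := by
  unfold uR gGauge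
  split_ifs <;> positivity

/-- on the window event `uR > 0`. [cite: BalabanImbrieJaffe1988, (5.12.3) p.301] -/
theorem Wset_subset_support_uR (t : Unit) : Wset P k t ⊆ Function.support (uR Ip Ix t) := by
  intro U hU
  have hU' : ∀ b : In (inIb (cD P k Ip Ix t)), |aOf 1 (uCut qU (ΛU P k t) U b.1)| ≤ rad P := fun b => hU b.1
  rw [Function.mem_support]
  unfold uR
  rw [if_pos hU', mul_one]
  unfold gGauge
  exact (Real.exp_pos _).ne'

/-- `uR` is integrable for `∫𝒟u δ_{Ax}`. [cite: BalabanImbrieJaffe1988, (5.12.3) p.301] -/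
theorem integrable_uR (t : Unit) : Integrable (uR Ip Ix t) (axialMeasure P k U1) := by
  have h := (integrable_uFactor (cD P k Ip Ix) (rad P) t (ΛU P k t) (axialMeasure P k U1)).re
  refine h.congr (ae_of_all _ fun U => ?_)
  show RCLike.re (((gGauge (cD P k Ip Ix t) (uCut qU (ΛU P k t) U) : ℝ) : ℂ) *
      Bwin (rad P) (fun b : In (inIb (cD P k Ip Ix t)) => aOf 1 (uCut qU (ΛU P k t) U b.1))) = uR Ip Ix t U
  rw [uC_eq_uR]
  simp

/-- **THE `u`-INTEGRAL OF THE BRACKET IS POSITIVE.** [cite: BalabanImbrieJaffe1988, (5.12.3) p.301] -/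
theorem integral_uR_pos (hk : k + 1 ≤ P.m + P.K) (t : Unit) : 0 < ∫ U, uR Ip Ix t U ∂axialMeasure P k U1 := by
  rw [integral_pos_iff_support_of_nonneg (fun U => uR_nonneg Ip Ix t U) (integrable_uR Ip Ix t)]
  exact (axialMeasure_Wset_pos hk t).trans_le (measure_mono (Wset_subset_support_uR Ip Ix t))

/-- the real Gaussian `e^{−½Σ|φ|²}` is integrable. [folklore] -/
private theorem integrable_gaussR (j : ℕ) : Integrable (fun φ : HiggsField P j => Real.exp (-(1 / 2) * ∑ x, ‖φ x‖ ^ 2)) := by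
  have h1 : Integrable (fun φ : HiggsField P j => ∏ x, Real.exp (-(1 / 2) * ‖φ x‖ ^ 2)) :=
    Integrable.fintype_prod (f := fun (_ : Balaban1983to89.Site P j) (z : ℂ) => Real.exp (-(1 / 2) * ‖z‖ ^ 2))
      fun _ => integrable_cgauss_site
  refine h1.congr (ae_of_all _ fun φ => ?_)
  simp only [Finset.mul_sum, Real.exp_sum]

/-- the `ψ`-Gaussian has positive integral. [cite: BalabanImbrieJaffe1988, (5.2.8) p.279] -/
theorem integral_gψ_eq : ∫ ψ, gψ P k ψ = ((∫ ψ : HiggsField P (k+1), Real.exp (-(1 / 2) * ∑ y, ‖ψ y‖ ^ 2) : ℝ) : ℂ) := by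
  unfold gψ
  exact integral_ofReal

/-- the scalar Gaussian has positive integral. [cite: BalabanImbrieJaffe1988, (5.12.2) p.301] -/
theorem integral_gScalarC_eq :
    ∫ φ, ((gScalar P k φ : ℝ) : ℂ) = ((∫ φ : HiggsField P k, Real.exp (-(1 / 2) * ∑ x, ‖φ x‖ ^ 2) : ℝ) : ℂ) := by
  simp_rw [gScalar_eq]
  exact integral_ofReal

/-- positivity of the Gaussian integrals. [folklore] -/
private theorem integral_gaussR_pos (j : ℕ) : 0 < ∫ φ : HiggsField P j, Real.exp (-(1 / 2) * ∑ x, ‖φ x‖ ^ 2) :=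
  integral_exp_pos (integrable_gaussR j)

/-- **THE NORMALIZATION OF THE (5.9.6) INPUT**: `∫dv dψ ρ^L_{k+1} = (∫𝒟u δ_{Ax} uR) · (∫dψ e^{−½Σ|ψ|²}) · (∫𝒟φ e^{−½Σ|φ|²})` (gen 9's
`integral_eq_of_isDT` on the certificate's (5.9.6) input, the bracket being a product of one-variable factors). [cite: BalabanImbrieJaffe1988, (5.9.6) p.297] -/
theorem integral_rhoL_eq (hk : k + 1 ≤ P.m + P.K) :
    ∫ v, ∫ ψ, rho596 {()} (ΛU P k) (cJ P k (cD P k Ip Ix) (rad P)) v ψ ∂volume ∂fieldMeasure P (k+1) U1 =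
      (∫ U, ((uR Ip Ix () U : ℝ) : ℂ) ∂axialMeasure P k U1) * ((∫ ψ, gψ P k ψ) * ∫ φ, ((gScalar P k φ : ℝ) : ℂ)) := by
  have h := isDT_rho596 (terms := {()}) (Λ := ΛU P k) (J₂ := cJ P k (cD P k Ip Ix) (rad P)) hk
    (fun t _ => integrable_fields (cD P k Ip Ix) (rad P) t)
  rw [integral_eq_of_isDT h, Finset.sum_singleton]
  have hJ : ∀ (prev : Prev P k) (u : GaugeField P k U1) (v : GaugeField P (k+1) U1) (φ : HiggsField P k) (ψ : HiggsField P (k+1)),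
      cJ P k (cD P k Ip Ix) (rad P) () prev u v φ ψ =
        (((gGauge (cD P k Ip Ix ()) u : ℝ) : ℂ) * Bwin (rad P) (fun b : In (inIb (cD P k Ip Ix ())) => aOf 1 (u b.1))) *
          (gψ P k ψ * ((gScalar P k φ : ℝ) : ℂ)) := by
    intro prev u v φ ψ
    simp only [cJ]
    ring
  simp_rw [hJ, uC_eq_uR, integral_const_mul, integral_mul_const, integral_const, probReal_univ, one_smul]

/-- **`∫dv dψ ρ^L_{k+1} ≠ 0`.** [cite: BalabanImbrieJaffe1988, (5.9.6) p.297] -/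
theorem integral_rhoL_ne_zero (hk : k + 1 ≤ P.m + P.K) :
    ∫ v, ∫ ψ, rho596 {()} (ΛU P k) (cJ P k (cD P k Ip Ix) (rad P)) v ψ ∂volume ∂fieldMeasure P (k+1) U1 ≠ 0 := by
  rw [integral_rhoL_eq Ip Ix hk, integral_complex_ofReal, integral_gψ_eq, integral_gScalarC_eq]
  have h1 := integral_uR_pos Ip Ix hk ()
  have h2 := integral_gaussR_pos (P := P) (k+1)
  have h3 := integral_gaussR_pos (P := P) k
  exact mul_ne_zero (Complex.ofReal_ne_zero.2 h1.ne') (mul_ne_zero (Complex.ofReal_ne_zero.2 h2.ne') (Complex.ofReal_ne_zero.2 h3.ne'))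

/-- **(N2) THE OUTPUT DENSITY `ρ^L_{k+1}` OF THE CERTIFICATE IS NOT `dv dψ`-ALMOST EVERYWHERE ZERO.** [cite: BalabanImbrieJaffe1988, (5.9.6) p.297] -/
theorem rhoL_not_ae_zero (hk : k + 1 ≤ P.m + P.K) :
    ¬ (∀ᵐ z ∂(fieldMeasure P (k+1) U1).prod (volume : Measure (HiggsField P (k+1))),
        rho596 {()} (ΛU P k) (cJ P k (cD P k Ip Ix) (rad P)) z.1 z.2 = 0) := by
  intro hae
  refine integral_rhoL_ne_zero Ip Ix hk ?_
  have h2 := Measure.ae_ae_of_ae_prod hae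
  calc ∫ v, ∫ ψ, rho596 {()} (ΛU P k) (cJ P k (cD P k Ip Ix) (rad P)) v ψ ∂volume ∂fieldMeasure P (k+1) U1
      = ∫ v, (0 : ℂ) ∂fieldMeasure P (k+1) U1 := by
        refine integral_congr_ae ?_
        filter_upwards [h2] with v hv
        exact integral_eq_zero_of_ae hv
    _ = 0 := integral_zero _ _

end Output

end

end Literature.MathematicalPhysics.QuantumFieldTheory.BalabanImbrieJaffe1984to88.BIJ88Eq5128NonVacuity
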